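import Summits.AtomisticToContinuum.FouriersLaw.Theses.EmbeddedDrudeMourre
import Literature.MathematicalPhysics.KineticTheory.InfiniteChainSuperstableOrbits
import Summits.AtomisticToContinuum.FouriersLaw.Theorems.EmbeddedDrudeMourreGreenKuboContinuationCanonicalSeedOfRegularState
import Summits.AtomisticToContinuum.FouriersLaw.Theorems.EmbeddedDrudeMourreAbelThermodynamicLimitKaramataRieszTwo
import Summits.AtomisticToContinuum.FouriersLaw.Theorems.EmbeddedDrudeMourreAbelThermodynamicLimitWitnessPositiveType
import Summits.AtomisticToContinuum.FouriersLaw.Theorems.EmbeddedDrudeMourreAbelThermodynamicLimitRegularDLRUnique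
import Summits.AtomisticToContinuum.FouriersLaw.Theorems.EmbeddedDrudeMourreAbelThermodynamicLimitFixedHorizonMatchingWindowLeaves
import Summits.AtomisticToContinuum.FouriersLaw.Theorems.EmbeddedDrudeMourreAbelThermodynamicLimitAnchoredKuboUniformMixing
import Summits.AtomisticToContinuum.FouriersLaw.Theorems.EmbeddedDrudeMourreAbelThermodynamicLimitUniformMixing
import Summits.AtomisticToContinuum.FouriersLaw.Theorems.EmbeddedDrudeMourreAbelThermodynamicLimitAnchoredCorrelationTails
import Summits.AtomisticToContinuum.FouriersLaw.Theorems.EmbeddedDrudeMourreAbelThermodynamicLimitFixedTimeOffsetMatching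
import Summits.AtomisticToContinuum.FouriersLaw.Theorems.LatticeLandauDampingAbelThermodynamicLimitWitnessRegularisationOfWitnessTightness
import HarnessLib

/-!
# `EmbeddedDrudeMourre.AbelThermodynamicLimit` from its two RESIDUALS — the certificate of line
`loomis-compact-horizon-witness` (crux stmt-AtomisticToContinuum-12596; `--supports` file proving the registered
reduction stub `stub_abelThermodynamicLimitOfResiduals`; closes nothing)

After waves 1–2 of the line (lead prover-line-stmt-AtomisticToContinuum-12596-0, 2026-08-16) every infrastructure
stub of the anchored Karamata line is a tree theorem: the Hardy–Littlewood–Karamata front end (S1,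
`stub_karamataRieszTwo`), positive type of the regular witness's current autocorrelation (S2,
`stub_witnessPositiveType`), the anchored fixed-`N` Kubo formula (S3 = `stub_anchoredKuboOfUniformMixing` + the
δ-uniform CEHR mixing `stub_uniformMixing`), open/closed matching at fixed horizon (S4 =
`stub_fixedHorizonMatchingOfDynamicalLeaves` + the `N`-uniform open-chain light cone `stub_anchoredCorrelationTails`
+ the two-dynamics matching `stub_fixedTimeOffsetMatching`), DLR uniqueness in the regular and in the tight class
(S7, `stub_regularDLRUnique`, `tightDLRUnique`), and the seam glue (`stub_witnessRegularisationOfWitnessTightness`,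
`tightRegular_of_tightUnique`, `regularWitness_of_regularState_of_aeOrbits`).  This file records the resulting
REDUCTION as an importable theorem:

  (WT)  witness states are one-site tight   →   (S5)  anchored post-dark stability of the open chain   →   the crux.

(WT) is the residual of the witness-identification seam (the crux's witness clause is bare DLR + arbitrary preserving
dynamics); (S5) is Disproof §4 step (3) — the `ν ↓ 0 ↔ N → ∞` exchange — in anchored time-domain form, equivalently
`D_N → κ` for the regular witness (crux-EQUIVALENT modulo the theorems above, planner's certificate
`anchoredPostDarkStability_of_crux` in `Lines/loomis_compact_horizon_witness.lean` rev 0).  So for BOTH `rfl`-twin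
routes (EmbeddedDrudeMourre 12596, LatticeLandauDamping 14013) the crux is exactly (WT) ∧ (S5).
No new definitions.
-/

noncomputable section

open MeasureTheory Filter Set
open scoped Topology NNReal BigOperators

namespace Summit.AtomisticToContinuum.FouriersLaw.Theorems.AbelThermodynamicLimit.LoomisCompactHorizonWitness

open Literature.MathematicalPhysics.KineticTheory.HeatConduction

/-- Real-variable scheme behind the line: if `g τ → L` (`τ → ∞`; the closed-chain compact-horizon witness),
`W N τ → g τ` for each fixed `τ > 0` (`N → ∞`; fixed-horizon matching) and `|d N - W N τ| ≤ ε` for `τ ≥ τ₀(ε)`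
and `N ≥ N₀(ε, τ)` (post-dark stability, (R) order), then `d N → L` (`ε/4` bookkeeping). [folklore] -/
theorem tendsto_of_window_scheme {d : ℕ → ℝ} {W : ℕ → ℝ → ℝ} {g : ℝ → ℝ} {L : ℝ}
    (hg : Tendsto g atTop (𝓝 L))
    (hW : ∀ τ : ℝ, 0 < τ → Tendsto (fun N => W N τ) atTop (𝓝 (g τ)))
    (hS : ∀ ε : ℝ, 0 < ε → ∃ τ₀ : ℝ, 0 < τ₀ ∧ ∀ τ : ℝ, τ₀ ≤ τ → ∃ N₀ : ℕ, ∀ N : ℕ, N₀ ≤ N →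
      |d N - W N τ| ≤ ε) :
    Tendsto d atTop (𝓝 L) := by
  rw [Metric.tendsto_atTop]
  intro ε hε
  have hε4 : 0 < ε / 4 := by positivity
  obtain ⟨τ₀, hτ₀, hτ⟩ := hS (ε / 4) hε4
  obtain ⟨τ₁, hτ₁⟩ := (Metric.tendsto_atTop.mp hg) (ε / 4) hε4
  set τ : ℝ := max τ₀ τ₁ with hτdef
  have hτpos : 0 < τ := lt_of_lt_of_le hτ₀ (le_max_left _ _)
  obtain ⟨N₀, hN₀⟩ := hτ τ (le_max_left _ _)
  obtain ⟨N₁, hN₁⟩ := (Metric.tendsto_atTop.mp (hW τ hτpos)) (ε / 4) hε4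
  refine ⟨max N₀ N₁, fun N hN => ?_⟩
  have h1 : |d N - W N τ| ≤ ε / 4 := hN₀ N (le_trans (le_max_left _ _) hN)
  have h2 : |W N τ - g τ| < ε / 4 := by
    have := hN₁ N (le_trans (le_max_right _ _) hN)
    rwa [Real.dist_eq] at this
  have h3 : |g τ - L| < ε / 4 := by
    have := hτ₁ τ (le_max_right _ _)
    rwa [Real.dist_eq] at this
  rw [Real.dist_eq]
  calc |d N - L| = |(d N - W N τ) + (W N τ - g τ) + (g τ - L)| := by ring_nf
    _ ≤ |(d N - W N τ) + (W N τ - g τ)| + |g τ - L| := abs_add_le _ _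
    _ ≤ |d N - W N τ| + |W N τ - g τ| + |g τ - L| := by
        gcongr
        exact abs_add_le _ _
    _ < ε / 4 + ε / 4 + ε / 4 := by linarith
    _ ≤ ε := by linarith

/-- **Registered reduction `stub_abelThermodynamicLimitOfResiduals` — THE CERTIFICATE OF THE LINE.**
(WT) witness states are one-site tight → (S5) anchored post-dark stability → the crux
`EmbeddedDrudeMourre.AbelThermodynamicLimit` BY NAME.  Proof = the line: regularise the given witness
((WT) + `tightDLRUnique` + `tightRegular_of_tightUnique` ⇒ regular state; `ae_forall_flow_mem_bmGood_pinnedChain`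
+ `regularWitness_of_regularState_of_aeOrbits` ⇒ carrier ⊆ bmGood) and OUTPUT the regular witness `(μT, D, κ)`;
positive type (S2) + Karamata (S1) give the compact-horizon witness `∫₀^τ (1-t/τ)² C_T → T²κ`; fixed-horizon
matching (S4, fed regular uniqueness S7) and (S5) give `A_N(0) → T²κ` by the window scheme; the anchored Kubo
formula (S3) identifies `A_N(0) = T² Dn N`. [folklore] -/
theorem stub_abelThermodynamicLimitOfResiduals :
    (
    ∀ ω₂ lam β γ : ℝ, 0 < ω₂ → 0 < lam → 0 < β → 0 < γ →
      ∀ T : ℝ, 0 < T →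
        ∀ (μ : MeasureTheory.Measure
                Literature.MathematicalPhysics.KineticTheory.HeatConduction.ChainConfig)
            (D : Literature.MathematicalPhysics.KineticTheory.HeatConduction.InfiniteChainDynamics
              (Literature.MathematicalPhysics.KineticTheory.HeatConduction.pinnedChain ω₂ lam β γ))
            (κ : ℝ),
            (Literature.MathematicalPhysics.KineticTheory.HeatConduction.pinnedChain
                ω₂ lam β γ).IsChainGibbsMeasure T μ → D.PreservesMeasure μ →
            (∀ t : ℝ, D.HasAbsConvergentCorrelation μ t) → 0 < κ →
            Filter.Tendsto (fun ν : ℝ => (T ^ 2)⁻¹ *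
              MeasureTheory.integral (MeasureTheory.volume.restrict (Set.Ioi (0:ℝ)))
                (fun t : ℝ => Real.exp (-(ν * t)) * D.currentCorrelation μ t))
              (nhdsWithin (0:ℝ) (Set.Ioi 0)) (nhds κ) →
            ∀ ε : ℝ, 0 < ε → ∃ R : ℝ, ∀ x : ℤ,
              μ {σ : Literature.MathematicalPhysics.KineticTheory.HeatConduction.ChainConfig |
                  R < |(σ x).1|} ≤ ENNReal.ofReal ε) →
    (
    ∀ ω₂ lam β γ : ℝ, 0 < ω₂ → 0 < lam → 0 < β → 0 < γ → ∀ T : ℝ, 0 < T →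
      (∃ (μT : MeasureTheory.Measure
              Literature.MathematicalPhysics.KineticTheory.HeatConduction.ChainConfig)
          (D : Literature.MathematicalPhysics.KineticTheory.HeatConduction.InfiniteChainDynamics
            (Literature.MathematicalPhysics.KineticTheory.HeatConduction.pinnedChain ω₂ lam β γ))
          (κ : ℝ),
          (Literature.MathematicalPhysics.KineticTheory.HeatConduction.pinnedChain
              ω₂ lam β γ).IsChainGibbsMeasure T μT ∧ D.PreservesMeasure μT ∧
          (∀ t : ℝ, D.HasAbsConvergentCorrelation μT t) ∧ 0 < κ ∧
          Filter.Tendsto (fun ν : ℝ => (T ^ 2)⁻¹ *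
            MeasureTheory.integral (MeasureTheory.volume.restrict (Set.Ioi (0:ℝ)))
              (fun t : ℝ => Real.exp (-(ν * t)) * D.currentCorrelation μT t))
            (nhdsWithin (0:ℝ) (Set.Ioi 0)) (nhds κ)) →
      ∀ ε : ℝ, 0 < ε → ∃ τ₀ : ℝ, 0 < τ₀ ∧ ∀ τ : ℝ, τ₀ ≤ τ → ∃ N₀ : ℕ, ∀ (N : ℕ), N₀ ≤ N →
        ∀ hN : 2 ≤ N,
          |(∑ k : Fin N, ∫ t in Set.Ioi (0 : ℝ),
              ∫ z, (Literature.MathematicalPhysics.KineticTheory.HeatConduction.pinnedChain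
                      ω₂ lam β γ).bondCurrent N ⟨(N - 1) / 2, by omega⟩ z *
                (∫ y, (Literature.MathematicalPhysics.KineticTheory.HeatConduction.pinnedChain
                      ω₂ lam β γ).bondCurrent N k y
                  ∂((Literature.MathematicalPhysics.KineticTheory.HeatConduction.pinnedChain
                      ω₂ lam β γ).transitionKernel N T T t.toNNReal z))
              ∂((Literature.MathematicalPhysics.KineticTheory.HeatConduction.pinnedChain
                      ω₂ lam β γ).gibbsMeasure N T)) -
            (∑ k : Fin N, ∫ t in Set.Ioc (0 : ℝ) τ, (1 - t / τ) ^ 2 *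
              ∫ z, (Literature.MathematicalPhysics.KineticTheory.HeatConduction.pinnedChain
                      ω₂ lam β γ).bondCurrent N ⟨(N - 1) / 2, by omega⟩ z *
                (∫ y, (Literature.MathematicalPhysics.KineticTheory.HeatConduction.pinnedChain
                      ω₂ lam β γ).bondCurrent N k y
                  ∂((Literature.MathematicalPhysics.KineticTheory.HeatConduction.pinnedChain
                      ω₂ lam β γ).transitionKernel N T T t.toNNReal z))
              ∂((Literature.MathematicalPhysics.KineticTheory.HeatConduction.pinnedChain
                      ω₂ lam β γ).gibbsMeasure N T))| ≤ ε) →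
    Summit.AtomisticToContinuum.FouriersLaw.Theses.EmbeddedDrudeMourre.AbelThermodynamicLimit := by
  intro hWT hS5 ω₂ lam β γ hω hl hβ hγ hU T hT hwit
  -- the seam: (WT) + tight uniqueness ⇒ a witness with regular state; then carrier ⊆ bmGood
  have hseam := Summit.AtomisticToContinuum.FouriersLaw.Theorems.AbelThermodynamicLimit.SeriesLawAtEveryLaplaceFrequency.stub_witnessRegularisationOfWitnessTightness
    ω₂ lam β γ hω hl hβ hγ T hT (hWT ω₂ lam β γ hω hl hβ hγ T hT)
    (Summit.AtomisticToContinuum.FouriersLaw.Theorems.AbelThermodynamicLimit.SeriesLawAtEveryLaplaceFrequency.tightRegular_of_tightUnique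
      γ hω hl.le hβ.le hT (tightDLRUnique ω₂ lam β γ hω hl hβ T hT)) hwit
  obtain ⟨μ₁, D₁, κ₁, hG₁, hS₁, hss₁, hP₁, hAC₁, hκ₁, hlim₁⟩ := hseam
  have horb : ∀ᵐ σ ∂μ₁, ∀ t : ℝ, D₁.flow t σ ∈ (pinnedChain ω₂ lam β γ).bmGood :=
    OscillatorChain.ae_forall_flow_mem_bmGood_pinnedChain γ hω.le hl hβ hss₁ D₁ hP₁
  obtain ⟨μT, D, κ, hG, hS, hss, hcar, hP, hAC, hκ, hAbel⟩ :=
    Summit.AtomisticToContinuum.FouriersLaw.Theorems.GreenKuboContinuation.TemperatureBlindVitaliHurwitz.regularWitness_of_regularState_of_aeOrbits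
      D₁ hG₁ hP₁ hAC₁ hκ₁ hlim₁ hS₁ hss₁ horb
  refine ⟨μT, D, κ, ⟨hG, hP, hAC, hκ, hAbel⟩, ?_⟩
  intro μ hμ Dn hDn
  have hT2 : (T ^ 2) ≠ 0 := pow_ne_zero 2 hT.ne'
  -- shorthand (proof-side only)
  let K : (N : ℕ) → 2 ≤ N → Fin N → ℝ → ℝ := fun N hN k t =>
    ∫ z, (pinnedChain ω₂ lam β γ).bondCurrent N ⟨(N - 1) / 2, by omega⟩ z *
        (∫ y, (pinnedChain ω₂ lam β γ).bondCurrent N k y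
            ∂((pinnedChain ω₂ lam β γ).transitionKernel N T T t.toNNReal z))
      ∂((pinnedChain ω₂ lam β γ).gibbsMeasure N T)
  let A : ℕ → ℝ := fun N => if h : 2 ≤ N then ∑ k : Fin N, ∫ t in Ioi (0:ℝ), K N h k t else 0
  let W : ℕ → ℝ → ℝ := fun N τ =>
    if h : 2 ≤ N then ∑ k : Fin N, ∫ t in Ioc (0:ℝ) τ, (1 - t / τ) ^ 2 * K N h k t else 0
  let g : ℝ → ℝ := fun τ => ∫ t in Ioc (0 : ℝ) τ, (1 - t / τ) ^ 2 * D.currentCorrelation μT t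
  -- witness side: positivity (S2), then Karamata (S1)
  obtain ⟨hmeas, ⟨M, hM⟩, hV⟩ :=
    stub_witnessPositiveType ω₂ lam β γ hω hl hβ hγ T hT μT D hG hS hss hcar hP hAC
  have hAbel' : Tendsto (fun ν : ℝ => ∫ t in Ioi (0 : ℝ),
      Real.exp (-(ν * t)) * D.currentCorrelation μT t) (𝓝[>] 0) (𝓝 (T ^ 2 * κ)) := by
    have h := hAbel.const_mul (T ^ 2)
    simp only [← mul_assoc, mul_inv_cancel₀ hT2, one_mul] at h
    exact h
  have hg : Tendsto g atTop (𝓝 (T ^ 2 * κ)) :=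
    stub_karamataRieszTwo (D.currentCorrelation μT) (T ^ 2 * κ) M hmeas hM hV hAbel'
  -- matching at fixed horizon (S4 from the two dynamical leaves, fed S7)
  have hmatch : ∀ τ : ℝ, 0 < τ → Tendsto (fun N : ℕ => W N τ) atTop (𝓝 (g τ)) :=
    stub_fixedHorizonMatchingOfDynamicalLeaves ω₂ lam β γ hω hl hβ hγ T hT
      (stub_anchoredCorrelationTails ω₂ lam β γ hω hl hβ hγ T hT)
      (stub_regularDLRUnique ω₂ lam β γ hω hl hβ hγ T hT) μT D hG hS hss hcar hP hAC
      (stub_fixedTimeOffsetMatching ω₂ lam β γ hω hl hβ hγ T hT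
        (stub_regularDLRUnique ω₂ lam β γ hω hl hβ hγ T hT) μT D hG hS hss hcar hP hAC)
  -- post-dark stability (S5)
  have hstab : ∀ ε : ℝ, 0 < ε → ∃ τ₀ : ℝ, 0 < τ₀ ∧ ∀ τ : ℝ, τ₀ ≤ τ → ∃ N₀ : ℕ, ∀ N : ℕ, N₀ ≤ N →
      |A N - W N τ| ≤ ε := by
    intro ε hε
    obtain ⟨τ₀, hτ₀, hτ⟩ := hS5 ω₂ lam β γ hω hl hβ hγ T hT hwit ε hε
    refine ⟨τ₀, hτ₀, fun τ hττ => ?_⟩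
    obtain ⟨N₀, hN₀⟩ := hτ τ hττ
    refine ⟨max N₀ 2, fun N hN => ?_⟩
    have hN2 : 2 ≤ N := le_trans (le_max_right _ _) hN
    have h := hN₀ N (le_trans (le_max_left _ _) hN) hN2
    simpa only [A, W, K, dif_pos hN2] using h
  have hA : Tendsto A atTop (𝓝 (T ^ 2 * κ)) := tendsto_of_window_scheme hg hmatch hstab
  -- anchored Kubo formula (S3 from the uniform mixing)
  have hd : A =ᶠ[atTop] fun N => T ^ 2 * Dn N := by
    filter_upwards [eventually_ge_atTop 2] with N hN
    have h := (stub_anchoredKuboOfUniformMixing ω₂ lam β γ hω hl hβ hγ hU T hT μ Dn hμ hDn N hN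
      (stub_uniformMixing ω₂ lam β γ hω hl hβ hγ T hT N hN)).2
    simp only [A, K, dif_pos hN]
    exact h.symm
  have hlim : Tendsto (fun N => T ^ 2 * Dn N) atTop (𝓝 (T ^ 2 * κ)) := hA.congr' hd
  have := hlim.const_mul ((T ^ 2)⁻¹)
  simpa [← mul_assoc, inv_mul_cancel₀ hT2] using this

end Summit.AtomisticToContinuum.FouriersLaw.Theorems.AbelThermodynamicLimit.LoomisCompactHorizonWitness

end
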